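/-
Copyright: lit-balaban cell, Phase-2 proof seat p33 (gen 11).  Statement-level skeleton of a published paper; no proof claims beyond
what the kernel checks below.
-/
import Literature.MathematicalPhysics.QuantumFieldTheory.BalabanImbrieJaffe1984to88.BIJ85LineSumReflection

/-!
# `BalabanImbrieJaffe1984to88.BIJ85EdgeColumnSums` — T. Bałaban, J. Imbrie, A. Jaffe, *Renormalization of the Higgs model: minimizers,
propagators and the stability of mean field theory*, Commun. Math. Phys. **97** (1985) 299–329 [BalabanImbrieJaffe1985], §7.3 p. 326:
the correction `T_kg = 𝒟_k∂*Q^{e*}_kg` of the second printed form of (7.3.2) IN EVERY DIMENSION `d ≥ 2` — **the pointwise bound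
`η|T_kg(b)| ≤ K_∞·max|g|` and the FAR-SOURCE line-sum bound `η|Σ_ℓ T_kg| ≤ K_far·max|g|`, both UNIFORM IN `k`**, by summing p09's
scale-`j` majorant (`BIJ85LineSumTkBound.abs_term_le`) over the edge columns `B^e_k(p)` AGAINST THE KERNEL (file 1/3 of the gen-11
member of SKELETON row **C1.Eq7.3.1-7.3.2**, GAPS G-C1-05 ADDENDUM 10 «WHAT REMAINS»: (γ′) for `d ≥ 3`; gen 10's
`BIJ85LineSumReflection.eta_abs_TkF_le_two` / `eta_abs_sum_TkF_far_le_two` are the case `d = 2`).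

statement-level skeleton of published theorems with citation tags; proofs where landed; nothing here is a claim about the Yang–Mills mass gap

THE PRINTED TEXT.  p. 326 [PDF 28], verbatim: *"The second form of the inequality substitutes v_b for u_k(b) in the covariant derivative
of φ. These inequalities can be proved by an extension of the proofs of [7]."*; p. 325 [PDF 27]: (7.2.2) `|H_{k,μν}(x,y)| + |∇H_{k,μν}(x,y)|
+ … ≦ Me^{−δ|x−y|}`, (7.2.3) `|C^{(k)}_{μν}(x,y)| ≦ Me^{−δ|x−y|}`; (2.21) p. 305: `(Q^ef)(p′) = L^{−(d−2)} Σ_{p∈B(p′)} f(p)`.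

WHY A NEW FILE.  p09's HONEST SCOPE (i) (`BIJ85LineSumTkBound`, GAPS G-C1-05 ADD. 7 SUPPL. 2 (A)): in `d ≥ 3` the scale-`j` majorant
carries the EXACT ambient factor `(L^{k−j})^{d−2}` of (7.2.3) and the columns `B^e_k(p)` have `(L^k)^{d−2}` plaquettes; bounding a column
by `card·max` (gen 10, `d = 2`, where the column is one plaquette) loses `(L^{k−j})^{d−2}` per scale.  The loss is real only for columns
ADJACENT to the line (their line sums are genuinely `∼L^{k−j}`: the obstruction of SUPPL. 2 (A), removed in file 2 by the symmetrisation);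
for the POINTWISE value and for FAR columns it is an artefact of `card·max`: of the `(L^k)^{d−2}` plaquettes of a column only
`∼(L^j)^{d−2}` lie within `L^j` of a given bond, and `(L^{k−j})^{d−2}(L^k)^{−(d−2)}(L^j)^{d−2} = 1`.

WHAT THIS FILE PROVES (0 `sorry`, theorems only — proof lane; standing range `k ≤ m + K`; operators OF RECORD `HkE`, `CE`, `QesOp`,
`curlOp`, `TkF`; p31's edge geometry `torusEdgeCellsTo`).
* §1 one-dimensional circular sums on `ℤ_N`: **`sum_exp_neg_cdist_sub_le`** (dense, `≤ 2(1 + b⁻¹)`), **`sum_exp_neg_val_div_le`** /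
  **`sum_sparse_exp_neg_cdist_le`** (ONE residue class mod `T ∣ N` summed at scale `T`: `≤ 2(1 + b⁻¹)` uniformly in `N`, `T` — the
  quotients by `T` are pairwise distinct on a residue class; `ZMod.castHom`).
* §2 **`sum_edgeSites_exp_le`**: `Σ_{z : z_α ≡ z_β ≡ −1 (mod L^k)} e^{−a|x − z|_∞/L^j} ≤ (2(1 + d/a))^d (L^j)^{d−2}` (`α ≠ β`, `j ≤ k`;
  product structure of `T^{(0)} = ℤ_N^d`, `Finset.prod_univ_sum`: the two sparse coordinates at scale `L^k`, the `d − 2` free ones at `L^j`).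
* §3 **`sum_edgePlaq_exp_le`**: `Σ_p Σ_{q∈B^e_k(p)} e^{−a|x − q₋|_∞/L^j} ≤ d²(2(1 + d/a))^d (L^j)^{d−2}` (the `B^e_k(p)` are pairwise disjoint,
  `Cells.B_unique`; an edge plaquette has both own-direction labels at offset `L^k − 1`, gen 10's `mod_eq_of_blockOfIter_shift`; fibres
  over the orientation).
* §4 **`eta_abs_TkF_le`** (every `d ≥ 2`): `η|T_kg(b)| ≤ K_∞·max|g|`, `K_∞ = 2·2M²M_Cd²e^{a/2}K(a)²·d²(2(1+d/a))^d`, `a = min(δ,δ_C)/2`,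
  `K(a) = (2(1+d/a))^d`, INDEPENDENT of `k` (scale-`j` share `∝ L^{−j}` after the bookkeeping `scale_bookkeeping`), given the two members
  of (7.2.2) for every `H_j` and (7.2.3) for every `C^{(j)}`, `j < k`.
* §5 **`eta_abs_sum_TkF_far_le`** (every `d ≥ 2`): if every plaquette charged by `g` has all its edge plaquettes at sup-distance `≥ L^k − 1`
  from the line `{x₀ + te_μ}`, then `η|Σ_{t<L^k} T_kg(x₀ + te_μ)| ≤ K_far·max|g|`, `K_far` explicit in `d, M, M_C, δ, δ_C` only: gen 10's
  rate split `a = a/3 + 2a/3` with the third split once more — `e^{−(a/6)(L^k−1)/L^j} ≤ (e^{−a/6})^{k−j}` sums over the scales and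
  `(L^{k−j})^{d−2}e^{−(a/6)(L^k−1)/L^j} ≤ e^{a/6}(d−2)!(6/a)^{d−2}` (`x^n/n! ≤ e^x`) absorbs the ambient factor.
HONEST SCOPE.  (i) Majorant bounds only (absolute values, no cancellation): they are k-uniform for the pointwise value and for far
sources in every `d`, and say nothing about line sums against near sources (file 2).  (ii) Constants explicit, far from optimal; `ℓ^∞`
torus distances; real fields, `U = 1`, torus, standing range.  (iii) Nothing printed is contradicted; no typed slot is altered; no
`def`, no `Prop` fact.

CITATION HEADER (lean-in-tree rule).  Phase-2 file of the lit-balaban TYPED SKELETON (HOME `run/shared/lean/pub/lit-balaban/`), seat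
p33 gen 11 (unit `lit-balaban-p33-g11`; TAKING line HOME/STATUS.md 2026-08-22T05:5xZ; owner r15, referee ref-5).
-/

open scoped BigOperators RealInnerProductSpace
open Finset

namespace Literature.MathematicalPhysics.QuantumFieldTheory.BalabanImbrieJaffe1984to88.BIJ85EdgeColumnSums

open Literature.MathematicalPhysics.QuantumFieldTheory.Balaban1983to89 hiding Site Plaq
open Balaban1983to89.LatticeFieldCalculus hiding runSite runBond runSite_zero
open Balaban1983to89.B3TorusRadialSums (cdist cdist_le_supDist sum_exp_neg_cdist_le tdist_le_mul_supDist tdist_eq_sum_cdist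
  supDist_comm)
open Balaban1983to89.B7SectAStatements (blockOfIter)
open BIJ85CellAverages (Cells)
open BIJ85Eq224Base0 (torusEdgeCellsTo)
open BIJ85AxialPropagator411 (BondSpace toE curlOp)
open BIJ85Prop521Torus (CoarseSpace toEj)
open BIJ85Prop522Torus (HkE CE DkE)
open BIJ85Sigma421Torus (UnitPlaqSpace toU QesOp)
open BIJ85Sigma422Eta (eta_pos eta_inv)
open BIJ85BlockAveragesTorus (runSite runBond runSite_zero runSite_shift)
open BIJ88Eq541Base0 (TkF)
open BIJ85LineSumTkKernel (TkF_eq_triple_sum)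
open BIJ85LineSumTkBound (runSite_apply_self sum_line_exp_le exp_worst_le abs_term_le)
open BIJ85Sect7Statements BIJ85Ineq722Torus
open BIJ85Ineq722DeltaA (deltaAData)
open BIJ88Decay216Torus (supDist_ctr_le_of_mem sum_exp_neg_distEU_le)
open BIJ85LineSumReflection (mod_eq_of_blockOfIter_shift two_le_sitesPerDir)
open Balaban1983to89 renaming Site → TSite, Plaq → TPlaq

noncomputable section

variable {P : Params}

/-! ## §1  One-dimensional circular sums -/

section OneDim

variable {N : ℕ} [NeZero N]

/-- kernel: a finite geometric sum with ratio `0 ≤ r < 1` is at most `(1 − r)⁻¹`. [folklore] -/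
private theorem geom_sum_le_inv {r : ℝ} (hr0 : 0 ≤ r) (hr1 : r < 1) (n : ℕ) : ∑ i ∈ range n, r ^ i ≤ (1 - r)⁻¹ := by
  have h1 : 0 < 1 - r := by linarith
  rw [inv_eq_one_div, le_div_iff₀ h1, geom_sum_mul_neg]
  have := pow_nonneg hr0 n
  linarith

/-- kernel: `(1 − e^{−b})⁻¹ ≤ 1 + b⁻¹` for `b > 0`. [folklore] -/
private theorem inv_one_sub_exp_neg_le {b : ℝ} (hb : 0 < b) : (1 - Real.exp (-b))⁻¹ ≤ 1 + b⁻¹ := by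
  have h1 : b + 1 ≤ Real.exp b := Real.add_one_le_exp b
  have h2 : Real.exp (-b) * Real.exp b = 1 := by rw [← Real.exp_add, neg_add_cancel, Real.exp_zero]
  have h3 : 0 < Real.exp (-b) := Real.exp_pos _
  have h4 : Real.exp (-b) < 1 := by rw [Real.exp_lt_one_iff]; linarith
  have h5 : 0 < 1 - Real.exp (-b) := by linarith
  rw [inv_le_comm₀ h5 (by positivity)]
  have h6 : (1 + b⁻¹)⁻¹ = b / (b + 1) := by field_simp
  rw [h6, div_le_iff₀ (by linarith)]
  nlinarith [mul_le_mul_of_nonneg_left h1 h3.le]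

/-- **the dense circular sum**: `Σ_{u ∈ ℤ_N} e^{−b·cdist(x − u)} ≤ 2(1 + b⁻¹)` (`B3TorusRadialSums.sum_exp_neg_cdist_le`, recentred).
[cite: Balaban1983Higgs3, (2.15) p.427] -/
theorem sum_exp_neg_cdist_sub_le {b : ℝ} (hb : 0 < b) (x : ZMod N) :
    ∑ u : ZMod N, Real.exp (-(b * (cdist (x - u) : ℝ))) ≤ 2 * (1 + b⁻¹) := by
  have h := Equiv.sum_comp (Equiv.subLeft x) (fun m : ZMod N => Real.exp (-(b * (cdist m : ℝ))))
  simp only [Equiv.subLeft_apply] at h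
  rw [h]
  exact sum_exp_neg_cdist_le hb

/-- **one residue class mod `T`, summed at scale `T`**: if all elements of `S ⊂ ℤ_N` (`T ∣ N`) have the same residue mod `T`, then
`Σ_{v∈S} e^{−b·v.val/T} ≤ 1 + b⁻¹` (the quotients `v.val / T` are pairwise distinct) — the one-dimensional lattice exponential sum
behind *"We get some constant O(1) depending on δ₁ and n̄ only"*. [cite: Balaban1983Higgs3, (2.15) p.427] -/
theorem sum_exp_neg_val_div_le {T : ℕ} (hT : 1 ≤ T) (hTN : T ∣ N) {b : ℝ} (hb : 0 < b) (S : Finset (ZMod N))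
    (hS : ∀ v ∈ S, ∀ v' ∈ S, ZMod.castHom hTN (ZMod T) v = ZMod.castHom hTN (ZMod T) v') :
    ∑ v ∈ S, Real.exp (-(b * ((v.val : ℝ) / T))) ≤ 1 + b⁻¹ := by
  classical
  have hT0 : (0 : ℝ) < T := by exact_mod_cast hT
  set r : ℝ := Real.exp (-b) with hr
  have hr0 : 0 ≤ r := (Real.exp_pos _).le
  have hr1 : r < 1 := by rw [hr]; exact Real.exp_lt_one_iff.2 (by linarith)
  -- termwise: `e^{−b v/T} ≤ r^{⌊v/T⌋}`
  have hpt : ∀ v : ZMod N, Real.exp (-(b * ((v.val : ℝ) / T))) ≤ r ^ (v.val / T) := by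
    intro v
    rw [hr, ← Real.exp_nat_mul]
    apply Real.exp_le_exp.2
    have h1 : ((v.val / T : ℕ) : ℝ) ≤ (v.val : ℝ) / T := Nat.cast_div_le
    nlinarith
  -- the quotient map is injective on `S`
  have hinj : Set.InjOn (fun v : ZMod N => v.val / T) S := by
    intro v hv v' hv' h
    have hc := hS v (Finset.mem_coe.1 hv) v' (Finset.mem_coe.1 hv')
    rw [ZMod.castHom_apply, ZMod.castHom_apply, ZMod.cast_eq_val, ZMod.cast_eq_val] at hc
    have hmod : v.val % T = v'.val % T := by
      have h1 := congrArg ZMod.val hc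
      rwa [ZMod.val_natCast, ZMod.val_natCast] at h1
    apply ZMod.val_injective
    have e1 := Nat.div_add_mod v.val T
    have e2 := Nat.div_add_mod v'.val T
    have h' : v.val / T = v'.val / T := h
    rw [← e1, ← e2, hmod, h']
  calc ∑ v ∈ S, Real.exp (-(b * ((v.val : ℝ) / T)))
      ≤ ∑ v ∈ S, r ^ (v.val / T) := Finset.sum_le_sum fun v _ => hpt v
    _ = ∑ n ∈ S.image (fun v : ZMod N => v.val / T), r ^ n := (Finset.sum_image hinj).symm
    _ ≤ ∑ n ∈ range N, r ^ n := by
        refine Finset.sum_le_sum_of_subset_of_nonneg (fun n hn => ?_) fun _ _ _ => pow_nonneg hr0 _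
        obtain ⟨v, _, rfl⟩ := Finset.mem_image.1 hn
        exact Finset.mem_range.2 (lt_of_le_of_lt (Nat.div_le_self _ _) (ZMod.val_lt v))
    _ ≤ (1 - r)⁻¹ := geom_sum_le_inv hr0 hr1 N
    _ ≤ 1 + b⁻¹ := by rw [hr]; exact inv_one_sub_exp_neg_le hb

/-- kernel: `e^{−b·min(p,q)} ≤ e^{−bp} + e^{−bq}` for `b ≥ 0`. [folklore] -/
private theorem exp_neg_min_le {b p q : ℝ} : Real.exp (-(b * min p q)) ≤ Real.exp (-(b * p)) + Real.exp (-(b * q)) := by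
  rcases min_choice p q with h | h
  · rw [h]; linarith [Real.exp_pos (-(b * q))]
  · rw [h]; linarith [Real.exp_pos (-(b * p))]

/-- kernel: an element of `ℤ_N` with `val ≡ T − 1 (mod T)` casts to `−1` in `ℤ_T` (`T ∣ N`). [folklore] -/
private theorem cast_eq_of_mod_eq {T : ℕ} (hTN : T ∣ N) {u : ZMod N} (hu : u.val % T = T - 1) :
    ZMod.castHom hTN (ZMod T) u = ((T - 1 : ℕ) : ZMod T) := by
  rw [ZMod.castHom_apply, ZMod.cast_eq_val, ← ZMod.natCast_mod u.val T, hu]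

/-- **THE SPARSE CIRCULAR SUM**: over ONE residue class mod `T` of `ℤ_N` (`T ∣ N`), at scale `T`,
`Σ_{u : u.val ≡ T−1 (T)} e^{−b·cdist(x − u)/T} ≤ 2(1 + b⁻¹)`, uniformly in `N`, `T` and `x` (the sparse variant of
`B3TorusRadialSums.sum_exp_neg_cdist_le`). [cite: Balaban1983Higgs3, (2.15) p.427] -/
theorem sum_sparse_exp_neg_cdist_le {T : ℕ} (hT : 1 ≤ T) (hTN : T ∣ N) {b : ℝ} (hb : 0 < b) (x : ZMod N) :
    ∑ u ∈ univ.filter (fun u : ZMod N => u.val % T = T - 1), Real.exp (-(b * ((cdist (x - u) : ℝ) / T))) ≤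
      2 * (1 + b⁻¹) := by
  classical
  set R := univ.filter (fun u : ZMod N => u.val % T = T - 1) with hR
  have hT0 : (0 : ℝ) < T := by exact_mod_cast hT
  -- split `cdist` into the two representatives
  have hpt : ∀ u : ZMod N, Real.exp (-(b * ((cdist (x - u) : ℝ) / T))) ≤
      Real.exp (-(b * (((x - u).val : ℝ) / T))) + Real.exp (-(b * (((u - x).val : ℝ) / T))) := by
    intro u
    have e : (cdist (x - u) : ℝ) / T = min (((x - u).val : ℝ) / T) (((u - x).val : ℝ) / T) := by
      rw [cdist, neg_sub, Nat.cast_min, min_div_div_right hT0.le]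
    rw [e]
    exact exp_neg_min_le
  have hcastR : ∀ u ∈ R, ZMod.castHom hTN (ZMod T) u = ((T - 1 : ℕ) : ZMod T) := fun u hu =>
    cast_eq_of_mod_eq hTN (Finset.mem_filter.1 hu).2
  -- first representative
  have h1 : ∑ u ∈ R, Real.exp (-(b * (((x - u).val : ℝ) / T))) ≤ 1 + b⁻¹ := by
    have hinj : Set.InjOn (fun u : ZMod N => x - u) R := fun u _ u' _ h => by simpa using h
    rw [← Finset.sum_image (f := fun v : ZMod N => Real.exp (-(b * ((v.val : ℝ) / T)))) hinj]
    refine sum_exp_neg_val_div_le hT hTN hb _ fun v hv v' hv' => ?_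
    obtain ⟨u, hu, rfl⟩ := Finset.mem_image.1 hv
    obtain ⟨u', hu', rfl⟩ := Finset.mem_image.1 hv'
    rw [map_sub, map_sub, hcastR u hu, hcastR u' hu']
  -- second representative
  have h2 : ∑ u ∈ R, Real.exp (-(b * (((u - x).val : ℝ) / T))) ≤ 1 + b⁻¹ := by
    have hinj : Set.InjOn (fun u : ZMod N => u - x) R := fun u _ u' _ h => by simpa using h
    rw [← Finset.sum_image (f := fun v : ZMod N => Real.exp (-(b * ((v.val : ℝ) / T)))) hinj]
    refine sum_exp_neg_val_div_le hT hTN hb _ fun v hv v' hv' => ?_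
    obtain ⟨u, hu, rfl⟩ := Finset.mem_image.1 hv
    obtain ⟨u', hu', rfl⟩ := Finset.mem_image.1 hv'
    rw [map_sub, map_sub, hcastR u hu, hcastR u' hu']
  calc ∑ u ∈ R, Real.exp (-(b * ((cdist (x - u) : ℝ) / T)))
      ≤ ∑ u ∈ R, (Real.exp (-(b * (((x - u).val : ℝ) / T))) + Real.exp (-(b * (((u - x).val : ℝ) / T)))) :=
        Finset.sum_le_sum fun u _ => hpt u
    _ ≤ (1 + b⁻¹) + (1 + b⁻¹) := by rw [Finset.sum_add_distrib]; exact add_le_add h1 h2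
    _ = 2 * (1 + b⁻¹) := by ring

end OneDim

/-! ## §2  The product structure: sums over the sites with two prescribed sparse coordinates -/

/-- kernel: `e^{−a|x − z|_∞/c} ≤ Π_λ e^{−(a/d)·cdist(x_λ − z_λ)/c}` (`|·|₁ ≤ d|·|_∞`). [cite: Balaban1983Higgs3, (2.15) p.427] -/
theorem exp_neg_supDist_le_prod {j : ℕ} {a c : ℝ} (ha : 0 ≤ a) (hc : 0 < c) (x z : TSite P j) :
    Real.exp (-(a * ((supDist x z : ℝ) / c))) ≤
      ∏ lam : Fin P.d, Real.exp (-(a / P.d * ((cdist (x lam - z lam) : ℝ) / c))) := by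
  have hd : (0 : ℝ) < P.d := by exact_mod_cast P.hd
  rw [← Real.exp_sum]
  apply Real.exp_le_exp.2
  have h1 : ((Site.tdist x z : ℕ) : ℝ) ≤ (P.d : ℝ) * (supDist x z : ℝ) := by exact_mod_cast tdist_le_mul_supDist x z
  rw [tdist_eq_sum_cdist] at h1
  push_cast at h1
  have e : ∑ lam : Fin P.d, -(a / P.d * ((cdist (x lam - z lam) : ℝ) / c)) =
      -(a / P.d / c * ∑ lam : Fin P.d, (cdist (x lam - z lam) : ℝ)) := by
    rw [Finset.mul_sum, ← Finset.sum_neg_distrib]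
    refine Finset.sum_congr rfl fun lam _ => by ring
  rw [e, neg_le_neg_iff]
  calc a / P.d / c * ∑ lam : Fin P.d, (cdist (x lam - z lam) : ℝ) ≤ a / P.d / c * ((P.d : ℝ) * (supDist x z : ℝ)) :=
        mul_le_mul_of_nonneg_left h1 (by positivity)
    _ = a * ((supDist x z : ℝ) / c) := by field_simp

/-- **THE EDGE-DIAGONAL LATTICE SUM**: over the sites `z` of `T^{(0)}` whose `α`- and `β`-labels are `≡ −1 (mod L^k)` (`α ≠ β`; the
possible base points of the edge plaquettes of orientation `(α, β)` of the k-blocks), for `j ≤ k ≤ m + K` and `a > 0`,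
`Σ_z e^{−a|x − z|_∞/L^j} ≤ (2(1 + d/a))^d·(L^j)^{d−2}` uniformly in `x`, `k` and the volume — product structure of the torus: the two
sparse coordinates are summed at scale `L^k` (`sum_sparse_exp_neg_cdist_le`), the `d − 2` free ones at scale `L^j`.
[cite: BalabanImbrieJaffe1985, (7.2.2) p.325] -/
theorem sum_edgeSites_exp_le {k j : ℕ} (hk : k ≤ P.m + P.K) (hjk : j ≤ k) {a : ℝ} (ha : 0 < a) (x : TSite P 0)
    {α β : Fin P.d} (hαβ : α ≠ β) :
    ∑ z ∈ univ.filter (fun z : TSite P 0 => (z α).val % P.L ^ k = P.L ^ k - 1 ∧ (z β).val % P.L ^ k = P.L ^ k - 1),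
        Real.exp (-(a * ((supDist x z : ℝ) / (P.L : ℝ) ^ j))) ≤
      (2 * (1 + P.d / a)) ^ P.d * ((P.L : ℝ) ^ j) ^ (P.d - 2) := by
  classical
  set T := P.L ^ k with hT
  have hT1 : 1 ≤ T := Nat.one_le_pow _ _ P.L_pos
  have hTN : T ∣ P.sitesPerDir 0 := by rw [sitesPerDir_zero_eq hk]; exact Dvd.intro_left _ rfl
  have hd : (0 : ℝ) < P.d := by exact_mod_cast P.hd
  have hLj : 0 < (P.L : ℝ) ^ j := pow_pos P.cast_L_pos j
  have hLj1 : 1 ≤ (P.L : ℝ) ^ j := one_le_pow₀ (by exact_mod_cast P.L_pos)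
  have hLjk : (P.L : ℝ) ^ j ≤ (P.L : ℝ) ^ k := pow_le_pow_right₀ (by exact_mod_cast P.L_pos) hjk
  have hTr : ((T : ℕ) : ℝ) = (P.L : ℝ) ^ k := by rw [hT, Nat.cast_pow]
  set R : Finset (ZMod (P.sitesPerDir 0)) := univ.filter (fun u => u.val % T = T - 1) with hR
  let t : Fin P.d → Finset (ZMod (P.sitesPerDir 0)) := fun lam => if lam = α ∨ lam = β then R else univ
  set c : ℝ := 2 * (1 + P.d / a) with hc
  have hc0 : 0 ≤ c := by rw [hc]; positivity
  -- the index set is the product set `piFinset t`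
  have hset : univ.filter (fun z : TSite P 0 => (z α).val % P.L ^ k = P.L ^ k - 1 ∧ (z β).val % P.L ^ k = P.L ^ k - 1) =
      Fintype.piFinset t := by
    ext z
    have hm : z ∈ Fintype.piFinset t ↔ ∀ lam, z lam ∈ t lam := Fintype.mem_piFinset
    simp only [Finset.mem_filter, Finset.mem_univ, true_and]
    constructor
    · rintro ⟨h1, h2⟩
      refine hm.2 fun lam => ?_
      by_cases h : lam = α ∨ lam = β
      · have ht : t lam = R := if_pos h
        rw [ht]
        rcases h with rfl | rfl
        · exact Finset.mem_filter.2 ⟨Finset.mem_univ _, h1⟩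
        · exact Finset.mem_filter.2 ⟨Finset.mem_univ _, h2⟩
      · have ht : t lam = univ := if_neg h
        rw [ht]
        exact Finset.mem_univ _
    · intro h
      have h' := hm.1 h
      have h1 := h' α
      have h2 := h' β
      have htα : t α = R := if_pos (Or.inl rfl)
      have htβ : t β = R := if_pos (Or.inr rfl)
      rw [htα] at h1
      rw [htβ] at h2
      exact ⟨(Finset.mem_filter.1 h1).2, (Finset.mem_filter.1 h2).2⟩
  -- termwise product bound and the exchange of sum and product
  let f : Fin P.d → ZMod (P.sitesPerDir 0) → ℝ := fun lam u =>
    Real.exp (-(a / P.d * ((cdist (x lam - u) : ℝ) / (P.L : ℝ) ^ j)))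
  have hf0 : ∀ lam u, 0 ≤ f lam u := fun _ _ => (Real.exp_pos _).le
  calc ∑ z ∈ univ.filter (fun z : TSite P 0 => (z α).val % P.L ^ k = P.L ^ k - 1 ∧ (z β).val % P.L ^ k = P.L ^ k - 1),
        Real.exp (-(a * ((supDist x z : ℝ) / (P.L : ℝ) ^ j)))
      = ∑ z ∈ Fintype.piFinset t, Real.exp (-(a * ((supDist x z : ℝ) / (P.L : ℝ) ^ j))) := Finset.sum_congr hset fun _ _ => rfl
    _ ≤ ∑ z ∈ Fintype.piFinset t, ∏ lam : Fin P.d, f lam (z lam) :=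
        Finset.sum_le_sum fun z _ => exp_neg_supDist_le_prod ha.le hLj x z
    _ = ∏ lam : Fin P.d, ∑ u ∈ t lam, f lam u := (Finset.prod_univ_sum t f).symm
    _ ≤ ∏ lam : Fin P.d, (c * if lam = α ∨ lam = β then (1 : ℝ) else (P.L : ℝ) ^ j) := by
        refine Finset.prod_le_prod (fun lam _ => Finset.sum_nonneg fun u _ => hf0 lam u) fun lam _ => ?_
        by_cases h : lam = α ∨ lam = β
        · -- sparse coordinate: scale `L^j` weakened to `L^k`
          simp only [t, if_pos h, mul_one]
          calc ∑ u ∈ R, f lam u ≤ ∑ u ∈ R, Real.exp (-(a / P.d * ((cdist (x lam - u) : ℝ) / T))) := by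
                refine Finset.sum_le_sum fun u _ => Real.exp_le_exp.2 ?_
                rw [hTr, neg_le_neg_iff]
                exact mul_le_mul_of_nonneg_left (div_le_div_of_nonneg_left (Nat.cast_nonneg _) hLj hLjk) (by positivity)
            _ ≤ 2 * (1 + (a / P.d)⁻¹) := sum_sparse_exp_neg_cdist_le hT1 hTN (by positivity) (x lam)
            _ = c := by rw [hc, inv_div]
        · -- free coordinate at scale `L^j`
          simp only [t, if_neg h]
          have e : ∀ u, f lam u = Real.exp (-(a / P.d / (P.L : ℝ) ^ j * (cdist (x lam - u) : ℝ))) := fun u => by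
            simp only [f]; ring_nf
          calc ∑ u : ZMod (P.sitesPerDir 0), f lam u
              = ∑ u : ZMod (P.sitesPerDir 0), Real.exp (-(a / P.d / (P.L : ℝ) ^ j * (cdist (x lam - u) : ℝ))) :=
                Finset.sum_congr rfl fun u _ => e u
            _ ≤ 2 * (1 + (a / P.d / (P.L : ℝ) ^ j)⁻¹) := sum_exp_neg_cdist_sub_le (by positivity) (x lam)
            _ = 2 * (1 + P.d * (P.L : ℝ) ^ j / a) := by congr 2; field_simp
            _ = 2 + 2 * ((P.d : ℝ) / a) * (P.L : ℝ) ^ j := by ring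
            _ ≤ 2 * (P.L : ℝ) ^ j + 2 * ((P.d : ℝ) / a) * (P.L : ℝ) ^ j := by linarith
            _ = c * (P.L : ℝ) ^ j := by rw [hc]; ring
    _ = c ^ P.d * ((P.L : ℝ) ^ j) ^ (P.d - 2) := by
        rw [Finset.prod_mul_distrib, Finset.prod_const, Finset.card_univ, Fintype.card_fin, Finset.prod_ite, Finset.prod_const_one,
          one_mul, Finset.prod_const]
        congr 2
        have hpair : univ.filter (fun lam : Fin P.d => lam = α ∨ lam = β) = {α, β} := by
          ext lam; simp
        have hsum := Finset.card_filter_add_card_filter_not (s := (univ : Finset (Fin P.d))) (fun lam : Fin P.d => lam = α ∨ lam = β)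
        rw [hpair, Finset.card_pair hαβ, Finset.card_univ, Fintype.card_fin] at hsum
        omega

/-! ## §3  From edge plaquettes to sites: `Σ_p Σ_{q∈B^e_k(p)}` -/

/-- kernel: the edge sets `B^e_k(p)` are pairwise disjoint (`Cells.B_unique`). [cite: BalabanImbrieJaffe1985, (2.21) p.305] -/
theorem pairwiseDisjoint_edgeB (hd : 2 ≤ P.d) (k : ℕ) :
    (Set.univ : Set (TPlaq P k)).PairwiseDisjoint (torusEdgeCellsTo P 0 k k (Nat.zero_add k) hd).B := by
  intro p _ p' _ hne
  rw [Function.onFun, Finset.disjoint_left]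
  intro q hq hq'
  exact hne (Cells.B_unique _ hq hq')

/-- kernel: an edge plaquette has both own-direction labels at offset `L^k − 1` of its k-block. [cite: BalabanImbrieJaffe1985, (2.21) p.305] -/
theorem mod_eq_of_mem_edgeB (hd : 2 ≤ P.d) {k : ℕ} (hk : k ≤ P.m + P.K) {p : TPlaq P k} {q : TPlaq P 0}
    (h : q ∈ (torusEdgeCellsTo P 0 k k (Nat.zero_add k) hd).B p) :
    (q.src q.μ).val % P.L ^ k = P.L ^ k - 1 ∧ (q.src q.ν).val % P.L ^ k = P.L ^ k - 1 := by
  have hc : blockOfIter k (q.src.shift q.μ) = (blockOfIter k q.src).shift q.μ ∧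
      blockOfIter k (q.src.shift q.ν) = (blockOfIter k q.src).shift q.ν := by
    rw [Cells.mem_B] at h
    dsimp only [torusEdgeCellsTo] at h
    split_ifs at h with hc
    exact hc
  exact ⟨mod_eq_of_blockOfIter_shift hk q.src _ hc.1, mod_eq_of_blockOfIter_shift hk q.src _ hc.2⟩

/-- **the fibre of one orientation**: for `α, β` and the edge condition in the own directions, the sum over the edge plaquettes
`q` of orientation `(α, β)` of `e^{−a|x − q₋|_∞/L^j}` is at most `(2(1 + d/a))^d·(L^j)^{d−2}` (`q ↦ q₋` is injective on the fibre and lands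
on the edge diagonal of §2; the fibre is empty unless `α < β`). [cite: BalabanImbrieJaffe1985, (2.21) p.305] -/
theorem sum_edgeFibre_exp_le {k j : ℕ} (hk : k ≤ P.m + P.K) (hjk : j ≤ k) {a : ℝ} (ha : 0 < a) (x : TSite P 0)
    (α β : Fin P.d) :
    ∑ q ∈ (univ.filter (fun q : TPlaq P 0 =>
        (q.src q.μ).val % P.L ^ k = P.L ^ k - 1 ∧ (q.src q.ν).val % P.L ^ k = P.L ^ k - 1)).filter (fun q => (q.μ, q.ν) = (α, β)),
        Real.exp (-(a * ((supDist x q.src : ℝ) / (P.L : ℝ) ^ j))) ≤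
      (2 * (1 + P.d / a)) ^ P.d * ((P.L : ℝ) ^ j) ^ (P.d - 2) := by
  classical
  by_cases hαβ : α = β
  · have hempty : (univ.filter (fun q : TPlaq P 0 =>
        (q.src q.μ).val % P.L ^ k = P.L ^ k - 1 ∧ (q.src q.ν).val % P.L ^ k = P.L ^ k - 1)).filter
        (fun q => (q.μ, q.ν) = (α, β)) = ∅ := by
      refine Finset.eq_empty_of_forall_notMem fun q hq => ?_
      have h := (Finset.mem_filter.1 hq).2
      simp only [Prod.mk.injEq] at h
      have := q.hμν
      rw [h.1, h.2, hαβ] at this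
      exact lt_irrefl _ this
    rw [hempty, Finset.sum_empty]
    positivity
  · have hinj : Set.InjOn (fun q : TPlaq P 0 => q.src) ((univ.filter (fun q : TPlaq P 0 =>
        (q.src q.μ).val % P.L ^ k = P.L ^ k - 1 ∧ (q.src q.ν).val % P.L ^ k = P.L ^ k - 1)).filter
        (fun q => (q.μ, q.ν) = (α, β))) := by
      intro q hq q' hq' h
      have h1 := (Finset.mem_filter.1 (Finset.mem_coe.1 hq)).2
      have h2 := (Finset.mem_filter.1 (Finset.mem_coe.1 hq')).2
      simp only [Prod.mk.injEq] at h1 h2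
      obtain ⟨s, μ, ν, hμν⟩ := q
      obtain ⟨s', μ', ν', hμν'⟩ := q'
      simp only at h h1 h2
      obtain ⟨rfl, rfl⟩ := h1
      obtain ⟨rfl, rfl⟩ := h2
      subst h
      rfl
    rw [← Finset.sum_image (f := fun z : TSite P 0 => Real.exp (-(a * ((supDist x z : ℝ) / (P.L : ℝ) ^ j)))) hinj]
    refine le_trans ?_ (sum_edgeSites_exp_le hk hjk ha x hαβ)
    refine Finset.sum_le_sum_of_subset_of_nonneg (fun z hz => ?_) fun _ _ _ => (Real.exp_pos _).le
    obtain ⟨q, hq, rfl⟩ := Finset.mem_image.1 hz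
    have hq' := Finset.mem_filter.1 hq
    have hE := (Finset.mem_filter.1 hq'.1).2
    have hdir := hq'.2
    simp only [Prod.mk.injEq] at hdir
    obtain ⟨hμ, hν⟩ := hdir
    rw [hμ, hν] at hE
    exact Finset.mem_filter.2 ⟨Finset.mem_univ _, hE⟩

/-- **THE EDGE-PLAQUETTE LATTICE SUM** (every `d ≥ 2`): for `j ≤ k ≤ m + K`, `a > 0` and every fine site `x`,
`Σ_{p∈T^{(k)}} Σ_{q∈B^e_k(p)} e^{−a|x − q₋|_∞/L^j} ≤ d²·(2(1 + d/a))^d·(L^j)^{d−2}` — the edge sets are disjoint, an edge plaquette of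
orientation `(α, β)` has its base point on the edge diagonal `{z_α ≡ z_β ≡ −1 (mod L^k)}`, and §2.  (In `d = 2` each `B^e_k(p)` is one
plaquette; in `d ≥ 3` the columns have `(L^k)^{d−2}` plaquettes, of which only `∼(L^j)^{d−2}` are within `L^j` of `x`.)
[cite: BalabanImbrieJaffe1985, (2.21) p.305] -/
theorem sum_edgePlaq_exp_le (hd : 2 ≤ P.d) {k j : ℕ} (hk : k ≤ P.m + P.K) (hjk : j ≤ k) {a : ℝ} (ha : 0 < a) (x : TSite P 0) :
    ∑ p : TPlaq P k, ∑ q ∈ (torusEdgeCellsTo P 0 k k (Nat.zero_add k) hd).B p,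
        Real.exp (-(a * ((supDist x q.src : ℝ) / (P.L : ℝ) ^ j))) ≤
      (P.d : ℝ) ^ 2 * ((2 * (1 + P.d / a)) ^ P.d * ((P.L : ℝ) ^ j) ^ (P.d - 2)) := by
  classical
  have hB0 : 0 ≤ (2 * (1 + P.d / a)) ^ P.d * ((P.L : ℝ) ^ j) ^ (P.d - 2) := by positivity
  -- (i) disjoint union
  rw [← Finset.sum_biUnion ((pairwiseDisjoint_edgeB hd k).subset (Set.subset_univ _))]
  -- (ii) inside the edge set
  have h2 : univ.biUnion (torusEdgeCellsTo P 0 k k (Nat.zero_add k) hd).B ⊆ univ.filter (fun q : TPlaq P 0 =>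
      (q.src q.μ).val % P.L ^ k = P.L ^ k - 1 ∧ (q.src q.ν).val % P.L ^ k = P.L ^ k - 1) := by
    intro q hq
    obtain ⟨p, _, hqp⟩ := Finset.mem_biUnion.1 hq
    exact Finset.mem_filter.2 ⟨Finset.mem_univ _, mod_eq_of_mem_edgeB hd hk hqp⟩
  refine (Finset.sum_le_sum_of_subset_of_nonneg h2 fun _ _ _ => (Real.exp_pos _).le).trans ?_
  -- (iii) fibres over the orientation
  rw [← Finset.sum_fiberwise_of_maps_to (t := (univ ×ˢ univ : Finset (Fin P.d × Fin P.d))) (g := fun q : TPlaq P 0 => (q.μ, q.ν))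
    (fun _ _ => Finset.mem_univ _)]
  calc ∑ ab ∈ (univ ×ˢ univ : Finset (Fin P.d × Fin P.d)), ∑ q ∈ (univ.filter (fun q : TPlaq P 0 =>
          (q.src q.μ).val % P.L ^ k = P.L ^ k - 1 ∧ (q.src q.ν).val % P.L ^ k = P.L ^ k - 1)).filter (fun q => (q.μ, q.ν) = ab),
          Real.exp (-(a * ((supDist x q.src : ℝ) / (P.L : ℝ) ^ j)))
      ≤ ∑ _ab ∈ (univ ×ˢ univ : Finset (Fin P.d × Fin P.d)), (2 * (1 + P.d / a)) ^ P.d * ((P.L : ℝ) ^ j) ^ (P.d - 2) :=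
        Finset.sum_le_sum fun ab _ => sum_edgeFibre_exp_le hk hjk ha x ab.1 ab.2
    _ = (P.d : ℝ) ^ 2 * ((2 * (1 + P.d / a)) ^ P.d * ((P.L : ℝ) ^ j) ^ (P.d - 2)) := by
        rw [Finset.sum_const, Finset.card_product, Finset.card_univ, Fintype.card_fin, nsmul_eq_mul]; push_cast; ring

/-! ## §4  The pointwise bound `η|T_kg(b)| ≤ K_∞·max|g|`, every `d ≥ 2` -/

/-- kernel: `0 < L^n`. [folklore] -/
private theorem cast_pow_L_pos' (n : ℕ) : (0 : ℝ) < (P.L : ℝ) ^ n := pow_pos P.cast_L_pos n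

/-- kernel: there is a unit plaquette (`d ≥ 2`), so a uniform bound `|g| ≤ C` forces `0 ≤ C`. [folklore] -/
private theorem nonneg_of_bound (hd : 2 ≤ P.d) {k : ℕ} {g : TPlaq P k → ℝ} {C : ℝ} (hg : ∀ q, |g q| ≤ C) : 0 ≤ C :=
  (abs_nonneg _).trans (hg ⟨default, ⟨0, by omega⟩, ⟨1, by omega⟩, by simp [Fin.lt_def]⟩)

/-- kernel: the scale bookkeeping `(L^{k−j})^{d−2}·((L^k)^{d−2})⁻¹·(L^j)^{d−2} = 1` (`j ≤ k`). [folklore] -/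
private theorem scale_bookkeeping {k j : ℕ} (hjk : j ≤ k) (n : ℕ) :
    ((P.L : ℝ) ^ (k - j)) ^ n * (((P.L : ℝ) ^ k) ^ n)⁻¹ * ((P.L : ℝ) ^ j) ^ n = 1 := by
  have hLk : (0 : ℝ) < ((P.L : ℝ) ^ k) ^ n := pow_pos (cast_pow_L_pos' k) n
  have e : ((P.L : ℝ) ^ (k - j)) ^ n * ((P.L : ℝ) ^ j) ^ n = ((P.L : ℝ) ^ k) ^ n := by
    rw [← mul_pow, ← pow_add, Nat.sub_add_cancel hjk]
  calc ((P.L : ℝ) ^ (k - j)) ^ n * (((P.L : ℝ) ^ k) ^ n)⁻¹ * ((P.L : ℝ) ^ j) ^ n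
      = (((P.L : ℝ) ^ (k - j)) ^ n * ((P.L : ℝ) ^ j) ^ n) * (((P.L : ℝ) ^ k) ^ n)⁻¹ := by ring
    _ = 1 := by rw [e, mul_inv_cancel₀ hLk.ne']

/-- **THE POINTWISE BOUND ON THE CORRECTION, EVERY `d ≥ 2`**: `η·|(T_kg)(b)| ≤ K_∞·max|g|` at every η-bond `b`, with
`K_∞ = 2·2M²M_Cd²K(a)·d²(2(1+d/a))^d` (`a = min(δ,δ_C)/2`, `K(a) = e^{a/2}(2(1+d/a))^{2d}`) INDEPENDENT OF `k` — p09's scale-`j` majorant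
`abs_term_le` summed over ALL edge plaquettes at once (§3: the columns `B^e_k(p)` against the kernel, NOT `card·max`), size `L^{−j}` per
scale after the bookkeeping `(L^{k−j})^{d−2}(L^k)^{−(d−2)}(L^j)^{d−2} = 1`; given the two members of (7.2.2) for every `H_j`, `j < k`, and
(7.2.3) for every `C^{(j)}` (`k ≤ m + K`). (gen 10's `eta_abs_TkF_le_two` is the case `d = 2`.) [cite: BalabanImbrieJaffe1985, (7.2.2)–(7.2.3) p.325] -/
theorem eta_abs_TkF_le (hd : 2 ≤ P.d) {k : ℕ} (hk : k ≤ P.m + P.K) {a : ℝ} (ha : 0 < a)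
    {δ M δC MC : ℝ} (hδ : 0 < δ) (hδC : 0 < δC) (hMC : 0 ≤ MC)
    (hH : ∀ (j : ℕ) (hj : j ≤ P.m + P.K), j < k → ∀ (μ ν : Fin P.d) (x : TSite P 0) (y : TSite P j),
      |(torusRep P j (deltaAData hj a)).H (x, μ) (y, ν)| ≤ M * Real.exp (-(δ * distEU P j x y)))
    (hB : ∀ (j : ℕ) (hj : j ≤ P.m + P.K), j < k → ∀ (μ ν : Fin P.d) (x : TSite P 0) (y : TSite P j),
      ‖fun lam : Fin P.d => (P.L : ℝ) ^ j *
          ((torusRep P j (deltaAData hj a)).H (x.shift lam, μ) (y, ν) - (torusRep P j (deltaAData hj a)).H (x, μ) (y, ν))‖ ≤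
        M * Real.exp (-(δ * distEU P j x y)))
    (hC : ∀ j < k, ∀ b₁ b₂ : PBond P j, |⟪toEj P j (Pi.single b₁ 1),
      CE P ((P.eta j) ^ P.d) ((P.L : ℝ) ^ j) j (toEj P j (Pi.single b₂ 1))⟫| ≤ MC * Real.exp (-(δC * (supDist b₁.src b₂.src : ℝ))))
    (g : TPlaq P k → ℝ) {C : ℝ} (hg : ∀ q, |g q| ≤ C) (b : PBond P 0) :
    P.eta k * |TkF P hd ((P.eta k) ^ P.d) (P.eta k) k g b| ≤
      (2 * (2 * M ^ 2 * MC * (P.d : ℝ) ^ 2 * (Real.exp (min δ δC / 2 / 2) * ((2 * (1 + P.d / (min δ δC / 2))) ^ P.d) ^ 2) *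
        ((P.d : ℝ) ^ 2 * (2 * (1 + P.d / (min δ δC / 2))) ^ P.d))) * C := by
  set a₀ : ℝ := min δ δC / 2 with ha₀
  have ha₀p : 0 < a₀ := by rw [ha₀]; exact half_pos (lt_min hδ hδC)
  have hC0 : 0 ≤ C := nonneg_of_bound hd hg
  have hLk : 0 < (P.L : ℝ) ^ k := cast_pow_L_pos' k
  have hηk : P.eta k = ((P.L : ℝ) ^ k)⁻¹ := by rw [← eta_inv P k, inv_inv]
  set K1 : ℝ := Real.exp (a₀ / 2) * ((2 * (1 + P.d / a₀)) ^ P.d) ^ 2 with hK1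
  set S' : ℝ := (P.d : ℝ) ^ 2 * (2 * (1 + P.d / a₀)) ^ P.d with hS'
  set K₀ : ℝ := 2 * M ^ 2 * MC * (P.d : ℝ) ^ 2 * K1 * S' with hK₀
  -- the case k = 0: no scale, the correction vanishes
  rcases Nat.eq_zero_or_pos k with hk0 | hkpos
  · subst hk0
    rw [TkF_eq_triple_sum]
    simp only [Finset.range_zero, Finset.sum_empty, mul_zero, Finset.sum_const_zero, abs_zero]
    positivity
  have hK1p : 0 < K1 := by rw [hK1]; positivity
  have hS'p : 0 < S' := by rw [hS']; positivity
  have hK₀nn : 0 ≤ K₀ := by rw [hK₀]; positivity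
  set G := torusEdgeCellsTo P 0 k k (Nat.zero_add k) hd with hG
  -- the scale-j term at the bond `b` against the plaquette `p`
  let T : TPlaq P k → ℕ → ℝ := fun p j => ∑ b₁ : PBond P j, ∑ b₂ : PBond P j,
    HkE P ((P.eta k) ^ P.d) ((P.L : ℝ) ^ k) j (toEj P j (Pi.single b₁ 1)) b *
      ⟪toEj P j (Pi.single b₁ 1), CE P ((P.eta k) ^ P.d) ((P.L : ℝ) ^ k) j (toEj P j (Pi.single b₂ 1))⟫ *
      LinearMap.adjoint (HkE P ((P.eta k) ^ P.d) ((P.L : ℝ) ^ k) j)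
        (LinearMap.adjoint (curlOp (P := P) ((P.eta k) ^ P.d) ((P.L : ℝ) ^ k))
          (QesOp (P := P) hd ((P.eta k) ^ P.d) k (toU P k (Pi.single p 1)))) b₂
  have hrepr : TkF P hd ((P.eta k) ^ P.d) (P.eta k) k g b = ∑ p : TPlaq P k, g p * ∑ j ∈ Finset.range k, T p j := by
    rw [TkF_eq_triple_sum hd]
    simp_rw [eta_inv P k]
    rfl
  -- per (p, j): p09's §2 in its raw form (the face column against the kernel)
  have hterm : ∀ (p : TPlaq P k) (j : ℕ), j < k →
      |T p j| ≤ (2 * M ^ 2 * (MC * ((P.L : ℝ) ^ (k - j)) ^ (P.d - 2)) * (P.d : ℝ) ^ 2 * K1 * ((P.L : ℝ) ^ k / (P.L : ℝ) ^ j)) *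
        (((P.L : ℝ) ^ k) ^ (P.d - 2))⁻¹ *
          ∑ q ∈ G.B p, Real.exp (-(a₀ * ((supDist b.src q.src : ℝ) / (P.L : ℝ) ^ j))) := by
    intro p j hjk
    have h := abs_term_le hd hk hjk ha hδ hδC (hH j (by omega) hjk) (hB j (by omega) hjk) (hC j hjk) b p
    refine h.trans (le_of_eq ?_)
    rw [← ha₀, ← hK1]
  -- per scale: sum over ALL edge plaquettes (§3), then the bookkeeping
  have hscale : ∀ j ∈ Finset.range k, P.eta k * ∑ p : TPlaq P k, |g p| * |T p j| ≤ C * K₀ * ((P.L : ℝ)⁻¹) ^ j := by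
    intro j hj
    have hjk : j < k := Finset.mem_range.1 hj
    have hLj : 0 < (P.L : ℝ) ^ j := cast_pow_L_pos' j
    set Aj : ℝ := 2 * M ^ 2 * (MC * ((P.L : ℝ) ^ (k - j)) ^ (P.d - 2)) * (P.d : ℝ) ^ 2 * K1 * ((P.L : ℝ) ^ k / (P.L : ℝ) ^ j)
      with hAj
    set κ : ℝ := (((P.L : ℝ) ^ k) ^ (P.d - 2))⁻¹ with hκ
    have hAj0 : 0 ≤ Aj := by rw [hAj]; positivity
    have hκ0 : 0 ≤ κ := by rw [hκ]; positivity
    have hcol := sum_edgePlaq_exp_le hd hk hjk.le ha₀p b.src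
    have h1 : ∑ p : TPlaq P k, |g p| * |T p j| ≤
        C * (Aj * κ) * ∑ p : TPlaq P k, ∑ q ∈ G.B p, Real.exp (-(a₀ * ((supDist b.src q.src : ℝ) / (P.L : ℝ) ^ j))) := by
      rw [Finset.mul_sum]
      refine Finset.sum_le_sum fun p _ => ?_
      calc |g p| * |T p j| ≤ C * (Aj * κ * ∑ q ∈ G.B p, Real.exp (-(a₀ * ((supDist b.src q.src : ℝ) / (P.L : ℝ) ^ j)))) :=
            mul_le_mul (hg p) (hterm p j hjk) (abs_nonneg _) hC0
        _ = _ := by ring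
    have h2 : ∑ p : TPlaq P k, |g p| * |T p j| ≤ C * (Aj * κ) * ((P.d : ℝ) ^ 2 * ((2 * (1 + P.d / a₀)) ^ P.d * ((P.L : ℝ) ^ j) ^ (P.d - 2))) :=
      h1.trans (mul_le_mul_of_nonneg_left hcol (by positivity))
    -- `η·Aj·κ·(L^j)^{d−2} = 2M²M_Cd²K1·L^{−j}`
    have hkey : P.eta k * (Aj * κ) * ((P.L : ℝ) ^ j) ^ (P.d - 2) = 2 * M ^ 2 * MC * (P.d : ℝ) ^ 2 * K1 * ((P.L : ℝ)⁻¹) ^ j := by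
      have hbk := scale_bookkeeping (P := P) hjk.le (P.d - 2)
      have hη : P.eta k * ((P.L : ℝ) ^ k / (P.L : ℝ) ^ j) = ((P.L : ℝ)⁻¹) ^ j := by
        rw [hηk, inv_pow]; field_simp
      calc P.eta k * (Aj * κ) * ((P.L : ℝ) ^ j) ^ (P.d - 2)
          = 2 * M ^ 2 * MC * (P.d : ℝ) ^ 2 * K1 * (P.eta k * ((P.L : ℝ) ^ k / (P.L : ℝ) ^ j)) *
              (((P.L : ℝ) ^ (k - j)) ^ (P.d - 2) * κ * ((P.L : ℝ) ^ j) ^ (P.d - 2)) := by rw [hAj]; ring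
        _ = _ := by rw [hη, hκ, hbk, mul_one]
    calc P.eta k * ∑ p : TPlaq P k, |g p| * |T p j|
        ≤ P.eta k * (C * (Aj * κ) * ((P.d : ℝ) ^ 2 * ((2 * (1 + P.d / a₀)) ^ P.d * ((P.L : ℝ) ^ j) ^ (P.d - 2)))) :=
          mul_le_mul_of_nonneg_left h2 (eta_pos P k).le
      _ = C * (P.eta k * (Aj * κ) * ((P.L : ℝ) ^ j) ^ (P.d - 2)) * S' := by rw [hS']; ring
      _ = C * K₀ * ((P.L : ℝ)⁻¹) ^ j := by rw [hkey, hK₀]; ring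
  -- the geometric sum over the scales
  have hL2 : (2 : ℝ) ≤ P.L := by exact_mod_cast P.hL.2
  have hr0 : 0 ≤ (P.L : ℝ)⁻¹ := inv_nonneg.2 P.cast_L_pos.le
  have hr1 : (P.L : ℝ)⁻¹ < 1 := inv_lt_one_of_one_lt₀ (by linarith)
  have hgeom : ∑ j ∈ Finset.range k, ((P.L : ℝ)⁻¹) ^ j ≤ 2 := by
    refine (geom_sum_le_inv hr0 hr1 k).trans ?_
    have : (P.L : ℝ)⁻¹ ≤ 1 / 2 := by rw [inv_eq_one_div]; exact one_div_le_one_div_of_le two_pos hL2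
    rw [inv_le_comm₀ (by linarith) two_pos]
    linarith
  -- assemble
  rw [hrepr]
  calc P.eta k * |∑ p : TPlaq P k, g p * ∑ j ∈ Finset.range k, T p j|
      ≤ P.eta k * ∑ p : TPlaq P k, ∑ j ∈ Finset.range k, |g p| * |T p j| := by
        refine mul_le_mul_of_nonneg_left ((Finset.abs_sum_le_sum_abs _ _).trans (Finset.sum_le_sum fun p _ => ?_)) (eta_pos P k).le
        rw [abs_mul, ← Finset.mul_sum]
        exact mul_le_mul_of_nonneg_left (Finset.abs_sum_le_sum_abs _ _) (abs_nonneg _)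
    _ = ∑ j ∈ Finset.range k, P.eta k * ∑ p : TPlaq P k, |g p| * |T p j| := by rw [Finset.sum_comm, Finset.mul_sum]
    _ ≤ ∑ j ∈ Finset.range k, C * K₀ * ((P.L : ℝ)⁻¹) ^ j := Finset.sum_le_sum hscale
    _ = C * K₀ * ∑ j ∈ Finset.range k, ((P.L : ℝ)⁻¹) ^ j := by rw [Finset.mul_sum]
    _ ≤ C * K₀ * 2 := mul_le_mul_of_nonneg_left hgeom (by positivity)
    _ = 2 * K₀ * C := by ring
    _ = _ := by rw [hK₀, hK1, hS', ha₀]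

/-! ## §5  The line sum over FAR sources, uniformly in `k`, every `d ≥ 2` -/

/-- kernel: splitting the rate of a far term, one third for the distance gain, two thirds for p09's line count and worst bond.
[folklore] -/
private theorem exp_split_far {a x D : ℝ} (ha : 0 ≤ a) (hD : D ≤ x) :
    Real.exp (-(a * x)) ≤ Real.exp (-(a / 3 * D)) * Real.exp (-(2 * a / 3 * x)) := by
  rw [← Real.exp_add]
  apply Real.exp_le_exp.2
  nlinarith

/-- kernel: `n + 1 ≤ L^n` for `L ≥ 2`. [folklore] -/
private theorem succ_le_pow {L : ℕ} (hL : 2 ≤ L) : ∀ n : ℕ, n + 1 ≤ L ^ n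
  | 0 => by simp
  | n + 1 => by
    have ih := succ_le_pow hL n
    calc n + 1 + 1 ≤ 2 * (n + 1) := by omega
      _ ≤ 2 * L ^ n := Nat.mul_le_mul_left 2 ih
      _ ≤ L * L ^ n := Nat.mul_le_mul_right _ hL
      _ = L ^ (n + 1) := (pow_succ' L n).symm

/-- kernel: **half the far factor is geometric in the scale**: `e^{−(a/6)(L^k − 1)/L^j} ≤ (e^{−a/6})^{k−j}` (`(L^k−1)/L^j ≥ k − j`).
[cite: BalabanImbrieJaffe1985, (7.2.2) p.325] -/
private theorem exp_far_le {k j : ℕ} (hjk : j < k) {a : ℝ} (ha : 0 ≤ a) :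
    Real.exp (-(a / 6 * ((((P.L : ℝ) ^ k) - 1) / (P.L : ℝ) ^ j))) ≤ Real.exp (-(a / 6)) ^ (k - j) := by
  rw [← Real.exp_nat_mul]
  apply Real.exp_le_exp.2
  have hLj : 0 < (P.L : ℝ) ^ j := cast_pow_L_pos' j
  have h1 : ((k - j : ℕ) : ℝ) + 1 ≤ (P.L : ℝ) ^ (k - j) := by exact_mod_cast succ_le_pow P.hL.2 (k - j)
  have h2 : (P.L : ℝ) ^ k = (P.L : ℝ) ^ (k - j) * (P.L : ℝ) ^ j := by rw [← pow_add, Nat.sub_add_cancel hjk.le]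
  have h3 : ((k - j : ℕ) : ℝ) ≤ ((P.L : ℝ) ^ k - 1) / (P.L : ℝ) ^ j := by
    rw [le_div_iff₀ hLj, h2]
    have h0 : 0 ≤ ((k - j : ℕ) : ℝ) := Nat.cast_nonneg _
    have hLj1 : 1 ≤ (P.L : ℝ) ^ j := one_le_pow₀ (by exact_mod_cast P.L_pos)
    nlinarith
  nlinarith

/-- kernel: **the other half of the far factor absorbs the ambient scaling factor of (7.2.3)**: for `j < k`, `b > 0` and every `n`,
`(L^{k−j})^n · e^{−b(L^k − 1)/L^j} ≤ e^b·n!·b^{−n}` (`(L^k−1)/L^j ≥ L^{k−j} − 1` and `x^n/n! ≤ e^x`). [folklore] -/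
private theorem pow_mul_exp_far_le {k j : ℕ} (hjk : j < k) {b : ℝ} (hb : 0 < b) (n : ℕ) :
    ((P.L : ℝ) ^ (k - j)) ^ n * Real.exp (-(b * ((((P.L : ℝ) ^ k) - 1) / (P.L : ℝ) ^ j))) ≤
      Real.exp b * n.factorial * (b⁻¹) ^ n := by
  set X : ℝ := (P.L : ℝ) ^ (k - j) with hX
  have hX0 : 0 ≤ X := by rw [hX]; positivity
  have hLj : 0 < (P.L : ℝ) ^ j := cast_pow_L_pos' j
  have hLj1 : 1 ≤ (P.L : ℝ) ^ j := one_le_pow₀ (by exact_mod_cast P.L_pos)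
  have h2 : (P.L : ℝ) ^ k = X * (P.L : ℝ) ^ j := by rw [hX, ← pow_add, Nat.sub_add_cancel hjk.le]
  -- `(L^k − 1)/L^j ≥ X − 1`
  have hfrac : X - 1 ≤ (((P.L : ℝ) ^ k) - 1) / (P.L : ℝ) ^ j := by
    rw [le_div_iff₀ hLj, h2]
    nlinarith
  have hexp : Real.exp (-(b * ((((P.L : ℝ) ^ k) - 1) / (P.L : ℝ) ^ j))) ≤ Real.exp b * Real.exp (-(b * X)) := by
    rw [← Real.exp_add]
    exact Real.exp_le_exp.2 (by nlinarith)
  -- `X^n e^{−bX} ≤ n!·b^{−n}`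
  have hfac : 0 < (n.factorial : ℝ) := by exact_mod_cast Nat.factorial_pos n
  have hpow : (b * X) ^ n ≤ n.factorial * Real.exp (b * X) := by
    have h := Real.pow_div_factorial_le_exp (b * X) (by positivity) n
    rw [div_le_iff₀ hfac] at h
    exact h.trans (le_of_eq (mul_comm _ _))
  have hbn : 0 < b ^ n := pow_pos hb n
  have hXn : X ^ n = (b * X) ^ n * (b⁻¹) ^ n := by
    rw [mul_pow, inv_pow]; field_simp
  have hkey : X ^ n * Real.exp (-(b * X)) ≤ n.factorial * (b⁻¹) ^ n := by
    rw [hXn]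
    have hE : Real.exp (b * X) * Real.exp (-(b * X)) = 1 := by rw [← Real.exp_add, add_neg_cancel, Real.exp_zero]
    calc (b * X) ^ n * (b⁻¹) ^ n * Real.exp (-(b * X))
        ≤ (n.factorial * Real.exp (b * X)) * (b⁻¹) ^ n * Real.exp (-(b * X)) :=
          mul_le_mul_of_nonneg_right (mul_le_mul_of_nonneg_right hpow (by positivity)) (Real.exp_pos _).le
      _ = n.factorial * (b⁻¹) ^ n * (Real.exp (b * X) * Real.exp (-(b * X))) := by ring
      _ = n.factorial * (b⁻¹) ^ n := by rw [hE, mul_one]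
  calc X ^ n * Real.exp (-(b * ((((P.L : ℝ) ^ k) - 1) / (P.L : ℝ) ^ j)))
      ≤ X ^ n * (Real.exp b * Real.exp (-(b * X))) := mul_le_mul_of_nonneg_left hexp (pow_nonneg hX0 n)
    _ = Real.exp b * (X ^ n * Real.exp (-(b * X))) := by ring
    _ ≤ Real.exp b * (n.factorial * (b⁻¹) ^ n) := mul_le_mul_of_nonneg_left hkey (Real.exp_pos _).le
    _ = _ := by ring

/-- kernel: a sum over the unit plaquettes of a nonnegative function of the base point is at most `d²` times the sum over the
sites (p09's private `sum_plaq_src_le`). [folklore] -/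
private theorem sum_plaq_src_le' {k : ℕ} (f : TSite P k → ℝ) (hf : ∀ y, 0 ≤ f y) :
    ∑ p : TPlaq P k, f p.src ≤ (P.d : ℝ) ^ 2 * ∑ y : TSite P k, f y := by
  classical
  rw [← Finset.sum_fiberwise_of_maps_to (s := (Finset.univ : Finset (TPlaq P k))) (t := (Finset.univ : Finset (TSite P k)))
    (g := fun p : TPlaq P k => p.src) (fun _ _ => Finset.mem_univ _), Finset.mul_sum]
  refine Finset.sum_le_sum fun y _ => ?_
  have hfib : ∑ p ∈ Finset.univ.filter (fun p : TPlaq P k => p.src = y), f p.src =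
      ((Finset.univ.filter (fun p : TPlaq P k => p.src = y)).card : ℝ) * f y := by
    rw [Finset.sum_congr rfl (fun p hp => by rw [(Finset.mem_filter.1 hp).2]), Finset.sum_const, nsmul_eq_mul]
  rw [hfib]
  refine mul_le_mul_of_nonneg_right ?_ (hf y)
  have hcard : (Finset.univ.filter (fun p : TPlaq P k => p.src = y)).card ≤
      (Finset.univ ×ˢ Finset.univ : Finset (Fin P.d × Fin P.d)).card := by
    refine Finset.card_le_card_of_injOn (fun p => (p.μ, p.ν)) (fun _ _ => Finset.mem_coe.2 (Finset.mem_univ _)) ?_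
    intro p hp p' hp' h
    have h1 := (Finset.mem_filter.1 (Finset.mem_coe.1 hp)).2
    have h2 := (Finset.mem_filter.1 (Finset.mem_coe.1 hp')).2
    obtain ⟨s, μ, ν, hμν⟩ := p
    obtain ⟨s', μ', ν', hμν'⟩ := p'
    simp only [Prod.mk.injEq] at h
    simp only at h1 h2
    subst h1; subst h2
    obtain ⟨rfl, rfl⟩ := h
    rfl
  rw [Finset.card_product, Finset.card_univ, Fintype.card_fin] at hcard
  have : ((Finset.univ.filter (fun p : TPlaq P k => p.src = y)).card : ℝ) ≤ ((P.d * P.d : ℕ) : ℝ) := by exact_mod_cast hcard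
  simpa [sq] using this

/-- **THE LINE SUM OVER FAR SOURCES IS BOUNDED UNIFORMLY IN `k`, EVERY `d ≥ 2`**: if every unit plaquette `p` charged by `g` has all
its edge plaquettes at sup-distance `≥ L^k − 1` from every site of the line `{x₀ + te_μ : t < L^k}`, then
`η·|Σ_{t<L^k}(T_kg)(x₀ + te_μ)| ≤ K_far·max|g|` with `K_far` depending only on `d, M, M_C, δ, δ_C` — p09's scale-`j` line bound with the
rate split `a = a/3 + 2a/3`; the third spent on the distance `≥ L^k − 1` is split again: `e^{−(a/6)(L^k−1)/L^j} ≤ (e^{−a/6})^{k−j}` is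
summable over the scales, and `(L^{k−j})^{d−2}e^{−(a/6)(L^k−1)/L^j} ≤ e^{a/6}(d−2)!(6/a)^{d−2}` absorbs the ambient scaling factor of
(7.2.3) that gen 10's `d = 2` file did not meet (`k ≤ m + K`, given (7.2.2) for `H_j`, (7.2.3) for `C^{(j)}`, `j < k`).
[cite: BalabanImbrieJaffe1985, (7.2.2)–(7.2.3) p.325] -/
theorem eta_abs_sum_TkF_far_le (hd : 2 ≤ P.d) {k : ℕ} (hk : k ≤ P.m + P.K) {a : ℝ} (ha : 0 < a)
    {δ M δC MC : ℝ} (hδ : 0 < δ) (hδC : 0 < δC) (hMC : 0 ≤ MC)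
    (hH : ∀ (j : ℕ) (hj : j ≤ P.m + P.K), j < k → ∀ (μ ν : Fin P.d) (x : TSite P 0) (y : TSite P j),
      |(torusRep P j (deltaAData hj a)).H (x, μ) (y, ν)| ≤ M * Real.exp (-(δ * distEU P j x y)))
    (hB : ∀ (j : ℕ) (hj : j ≤ P.m + P.K), j < k → ∀ (μ ν : Fin P.d) (x : TSite P 0) (y : TSite P j),
      ‖fun lam : Fin P.d => (P.L : ℝ) ^ j *
          ((torusRep P j (deltaAData hj a)).H (x.shift lam, μ) (y, ν) - (torusRep P j (deltaAData hj a)).H (x, μ) (y, ν))‖ ≤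
        M * Real.exp (-(δ * distEU P j x y)))
    (hC : ∀ j < k, ∀ b₁ b₂ : PBond P j, |⟪toEj P j (Pi.single b₁ 1),
      CE P ((P.eta j) ^ P.d) ((P.L : ℝ) ^ j) j (toEj P j (Pi.single b₂ 1))⟫| ≤ MC * Real.exp (-(δC * (supDist b₁.src b₂.src : ℝ))))
    (x₀ : TSite P 0) (μ : Fin P.d) (g : TPlaq P k → ℝ) {C : ℝ} (hg : ∀ q, |g q| ≤ C)
    (hfar : ∀ p : TPlaq P k, g p ≠ 0 → ∀ q ∈ (torusEdgeCellsTo P 0 k k (Nat.zero_add k) hd).B p, ∀ t ∈ range (P.L ^ k),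
      (P.L : ℝ) ^ k - 1 ≤ (supDist (runSite x₀ μ t) q.src : ℝ)) :
    P.eta k * |∑ t ∈ range (P.L ^ k), TkF P hd ((P.eta k) ^ P.d) (P.eta k) k g (runBond x₀ μ t)| ≤
      (2 * M ^ 2 * MC * (P.d : ℝ) ^ 2 * (Real.exp (min δ δC / 2 / 2) * ((2 * (1 + P.d / (min δ δC / 2))) ^ P.d) ^ 2) *
        (2 * (1 + 2 / (2 * (min δ δC / 2) / 3)) * Real.exp (3 * (2 * (min δ δC / 2) / 3) / 4) *
          ((P.d : ℝ) ^ 2 * (Real.exp ((2 * (min δ δC / 2) / 3) / 2 / 2) *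
            (2 * (1 + P.d / ((2 * (min δ δC / 2) / 3) / 2))) ^ P.d))) *
        (Real.exp (min δ δC / 2 / 6) * (P.d - 2).factorial * ((min δ δC / 2 / 6)⁻¹) ^ (P.d - 2)) *
        (1 - Real.exp (-(min δ δC / 2 / 6)))⁻¹) * C := by
  set a₀ : ℝ := min δ δC / 2 with ha₀
  have ha₀p : 0 < a₀ := by rw [ha₀]; exact half_pos (lt_min hδ hδC)
  set a₁ : ℝ := 2 * a₀ / 3 with ha₁
  have ha₁p : 0 < a₁ := by rw [ha₁]; positivity
  have hC0 : 0 ≤ C := nonneg_of_bound hd hg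
  have hLk : 0 < (P.L : ℝ) ^ k := cast_pow_L_pos' k
  have hηk : P.eta k = ((P.L : ℝ) ^ k)⁻¹ := by rw [← eta_inv P k, inv_inv]
  set K1 : ℝ := Real.exp (a₀ / 2) * ((2 * (1 + P.d / a₀)) ^ P.d) ^ 2 with hK1
  set S'' : ℝ := (P.d : ℝ) ^ 2 * (Real.exp (a₁ / 2 / 2) * (2 * (1 + P.d / (a₁ / 2))) ^ P.d) with hS''
  set W' : ℝ := 2 * (1 + 2 / a₁) with hW'
  set Kpoly : ℝ := Real.exp (a₀ / 6) * (P.d - 2).factorial * ((a₀ / 6)⁻¹) ^ (P.d - 2) with hKpoly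
  set Kf : ℝ := 2 * M ^ 2 * MC * (P.d : ℝ) ^ 2 * K1 * (W' * Real.exp (3 * a₁ / 4) * S'') * Kpoly with hKf
  set r : ℝ := Real.exp (-(a₀ / 6)) with hr
  have hr0 : 0 ≤ r := (Real.exp_pos _).le
  have hr1 : r < 1 := by rw [hr]; exact Real.exp_lt_one_iff.2 (by linarith)
  have hr1' : r ≤ 1 := hr1.le
  have hKpoly0 : 0 ≤ Kpoly := by rw [hKpoly]; positivity
  have hKf0 : 0 ≤ Kf := by rw [hKf]; positivity
  -- the case k = 0
  rcases Nat.eq_zero_or_pos k with hk0 | hkpos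
  · subst hk0
    simp only [pow_zero, Finset.range_one, Finset.sum_singleton]
    rw [TkF_eq_triple_sum]
    simp only [Finset.range_zero, Finset.sum_empty, mul_zero, Finset.sum_const_zero, abs_zero, mul_zero]
    have : 0 < 1 - r := by linarith
    positivity
  have hsites : P.L ^ k ≤ P.sitesPerDir 0 := by
    rw [sitesPerDir_zero_eq hk]
    exact Nat.le_mul_of_pos_left _ (by have := two_le_sitesPerDir (P := P) k; omega)
  -- the scale-j term at the bond `x₀ + te_μ` against the plaquette `p`
  let T : ℕ → TPlaq P k → ℕ → ℝ := fun t p j => ∑ b₁ : PBond P j, ∑ b₂ : PBond P j,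
    HkE P ((P.eta k) ^ P.d) ((P.L : ℝ) ^ k) j (toEj P j (Pi.single b₁ 1)) (runBond x₀ μ t) *
      ⟪toEj P j (Pi.single b₁ 1), CE P ((P.eta k) ^ P.d) ((P.L : ℝ) ^ k) j (toEj P j (Pi.single b₂ 1))⟫ *
      LinearMap.adjoint (HkE P ((P.eta k) ^ P.d) ((P.L : ℝ) ^ k) j)
        (LinearMap.adjoint (curlOp (P := P) ((P.eta k) ^ P.d) ((P.L : ℝ) ^ k))
          (QesOp (P := P) hd ((P.eta k) ^ P.d) k (toU P k (Pi.single p 1)))) b₂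
  have hrepr : ∑ t ∈ range (P.L ^ k), TkF P hd ((P.eta k) ^ P.d) (P.eta k) k g (runBond x₀ μ t) =
      ∑ t ∈ range (P.L ^ k), ∑ p : TPlaq P k, g p * ∑ j ∈ Finset.range k, T t p j := by
    refine Finset.sum_congr rfl fun t _ => ?_
    rw [TkF_eq_triple_sum hd]
    simp_rw [eta_inv P k]
    rfl
  -- per (t, p, j): p09's §2
  have hterm : ∀ (t : ℕ) (p : TPlaq P k) (j : ℕ), j < k →
      |T t p j| ≤ (2 * M ^ 2 * (MC * ((P.L : ℝ) ^ (k - j)) ^ (P.d - 2)) * (P.d : ℝ) ^ 2 * K1 * ((P.L : ℝ) ^ k / (P.L : ℝ) ^ j)) *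
        (((P.L : ℝ) ^ k) ^ (P.d - 2))⁻¹ *
          ∑ q ∈ (torusEdgeCellsTo P 0 k k (Nat.zero_add k) hd).B p, Real.exp (-(a₀ * ((supDist (runSite x₀ μ t) q.src : ℝ) / (P.L : ℝ) ^ j))) := by
    intro t p j hjk
    have h := abs_term_le hd hk hjk ha hδ hδC (hH j (by omega) hjk) (hB j (by omega) hjk) (hC j hjk) (runBond x₀ μ t) p
    have hsrc : (runBond x₀ μ t).src = runSite x₀ μ t := rfl
    rw [hsrc] at h
    refine h.trans (le_of_eq ?_)
    rw [← ha₀, ← hK1]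
  -- per (p, j): the line sum of the scale-j term against a FAR plaquette (verbatim from gen 10; every `d`)
  have hline : ∀ (p : TPlaq P k) (j : ℕ), j < k → g p ≠ 0 →
      ∑ t ∈ range (P.L ^ k), |T t p j| ≤
        (2 * M ^ 2 * (MC * ((P.L : ℝ) ^ (k - j)) ^ (P.d - 2)) * (P.d : ℝ) ^ 2 * K1 * ((P.L : ℝ) ^ k / (P.L : ℝ) ^ j)) *
          (Real.exp (-(a₀ / 3 * ((((P.L : ℝ) ^ k) - 1) / (P.L : ℝ) ^ j))) *
            (2 * (1 + 2 * (P.L : ℝ) ^ j / a₁) * Real.exp (3 * a₁ / 4) * Real.exp (-(a₁ / 2 * distEU P k x₀ p.src)))) := by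
    intro p j hjk hgp
    have hLj : 0 < (P.L : ℝ) ^ j := cast_pow_L_pos' j
    set A : ℝ := 2 * M ^ 2 * (MC * ((P.L : ℝ) ^ (k - j)) ^ (P.d - 2)) * (P.d : ℝ) ^ 2 * K1 * ((P.L : ℝ) ^ k / (P.L : ℝ) ^ j)
      with hA
    set κ : ℝ := (((P.L : ℝ) ^ k) ^ (P.d - 2))⁻¹ with hκ
    set E : ℝ := Real.exp (-(a₀ / 3 * ((((P.L : ℝ) ^ k) - 1) / (P.L : ℝ) ^ j))) with hE
    have hA0 : 0 ≤ A := by rw [hA]; positivity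
    have hκ0 : 0 ≤ κ := by rw [hκ]; positivity
    have hE0 : 0 ≤ E := (Real.exp_pos _).le
    have hsplit : ∀ t ∈ range (P.L ^ k), ∀ q ∈ (torusEdgeCellsTo P 0 k k (Nat.zero_add k) hd).B p,
        Real.exp (-(a₀ * ((supDist (runSite x₀ μ t) q.src : ℝ) / (P.L : ℝ) ^ j))) ≤
          E * Real.exp (-(a₁ * ((supDist (runSite x₀ μ t) q.src : ℝ) / (P.L : ℝ) ^ j))) := by
      intro t ht q hq
      have hD : (((P.L : ℝ) ^ k) - 1) / (P.L : ℝ) ^ j ≤ (supDist (runSite x₀ μ t) q.src : ℝ) / (P.L : ℝ) ^ j :=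
        div_le_div_of_nonneg_right (hfar p hgp q hq t ht) hLj.le
      have h := exp_split_far (x := (supDist (runSite x₀ μ t) q.src : ℝ) / (P.L : ℝ) ^ j) ha₀p.le hD
      rwa [hE, ha₁]
    have hq : ∀ q ∈ (torusEdgeCellsTo P 0 k k (Nat.zero_add k) hd).B p, ∑ t ∈ range (P.L ^ k), Real.exp (-(a₁ * ((supDist (runSite x₀ μ t) q.src : ℝ) / (P.L : ℝ) ^ j))) ≤
        2 * (1 + 2 * (P.L : ℝ) ^ j / a₁) * Real.exp (3 * a₁ / 4) * Real.exp (-(a₁ / 2 * distEU P k x₀ p.src)) := by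
      intro q hq
      calc _ ≤ 2 * (1 + 2 * (P.L : ℝ) ^ j / a₁) *
            Real.exp (-(a₁ / 2 * (max ((supDist x₀ q.src : ℝ) - ((P.L : ℝ) ^ k - 1)) 0 / (P.L : ℝ) ^ k))) :=
            sum_line_exp_le hjk.le hsites ha₁p x₀ μ q.src
        _ ≤ 2 * (1 + 2 * (P.L : ℝ) ^ j / a₁) * (Real.exp (3 * a₁ / 4) * Real.exp (-(a₁ / 2 * distEU P k x₀ p.src))) :=
            mul_le_mul_of_nonneg_left (exp_worst_le hd hk ha₁p x₀ hq) (by positivity)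
        _ = _ := by ring
    have hcardN : ((torusEdgeCellsTo P 0 k k (Nat.zero_add k) hd).B p).card = (P.L ^ k) ^ (P.d - 2) := BIJ85Eq224Base0.card_edgeBTo (Nat.zero_add k) hk hd p
    have hcard : (((torusEdgeCellsTo P 0 k k (Nat.zero_add k) hd).B p).card : ℝ) = ((P.L : ℝ) ^ k) ^ (P.d - 2) := by rw [hcardN]; push_cast; ring
    calc ∑ t ∈ range (P.L ^ k), |T t p j|
        ≤ ∑ t ∈ range (P.L ^ k), A * κ * ∑ q ∈ (torusEdgeCellsTo P 0 k k (Nat.zero_add k) hd).B p, Real.exp (-(a₀ * ((supDist (runSite x₀ μ t) q.src : ℝ) / (P.L : ℝ) ^ j))) :=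
          Finset.sum_le_sum fun t _ => hterm t p j hjk
      _ ≤ ∑ t ∈ range (P.L ^ k), A * κ * ∑ q ∈ (torusEdgeCellsTo P 0 k k (Nat.zero_add k) hd).B p, E * Real.exp (-(a₁ * ((supDist (runSite x₀ μ t) q.src : ℝ) / (P.L : ℝ) ^ j))) :=
          Finset.sum_le_sum fun t ht => mul_le_mul_of_nonneg_left (Finset.sum_le_sum fun q hq => hsplit t ht q hq) (mul_nonneg hA0 hκ0)
      _ = A * κ * E * ∑ q ∈ (torusEdgeCellsTo P 0 k k (Nat.zero_add k) hd).B p, ∑ t ∈ range (P.L ^ k), Real.exp (-(a₁ * ((supDist (runSite x₀ μ t) q.src : ℝ) / (P.L : ℝ) ^ j))) := by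
          rw [Finset.sum_comm]
          simp only [Finset.mul_sum]
          refine Finset.sum_congr rfl fun q _ => Finset.sum_congr rfl fun t _ => by ring
      _ ≤ A * κ * E * ∑ q ∈ (torusEdgeCellsTo P 0 k k (Nat.zero_add k) hd).B p, 2 * (1 + 2 * (P.L : ℝ) ^ j / a₁) * Real.exp (3 * a₁ / 4) * Real.exp (-(a₁ / 2 * distEU P k x₀ p.src)) :=
          mul_le_mul_of_nonneg_left (Finset.sum_le_sum hq) (by positivity)
      _ = A * (κ * ((torusEdgeCellsTo P 0 k k (Nat.zero_add k) hd).B p).card) * (E * (2 * (1 + 2 * (P.L : ℝ) ^ j / a₁) * Real.exp (3 * a₁ / 4) *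
            Real.exp (-(a₁ / 2 * distEU P k x₀ p.src)))) := by rw [Finset.sum_const, nsmul_eq_mul]; ring
      _ = _ := by rw [hcard, hκ, inv_mul_cancel₀ (pow_pos hLk _).ne', mul_one]
  -- per scale j: weights |g p|, sum over p, the factor η, and the scaling factor `(L^{k−j})^{d−2}` against half the far factor
  have hscale : ∀ j ∈ Finset.range k,
      P.eta k * ∑ p : TPlaq P k, ∑ t ∈ range (P.L ^ k), |g p| * |T t p j| ≤ C * Kf * r ^ (k - j) := by
    intro j hj
    have hjk : j < k := Finset.mem_range.1 hj
    have hLj : 0 < (P.L : ℝ) ^ j := cast_pow_L_pos' j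
    have hLj1 : 1 ≤ (P.L : ℝ) ^ j := one_le_pow₀ (by exact_mod_cast P.L_pos)
    set Aj : ℝ := 2 * M ^ 2 * (MC * ((P.L : ℝ) ^ (k - j)) ^ (P.d - 2)) * (P.d : ℝ) ^ 2 * K1 * ((P.L : ℝ) ^ k / (P.L : ℝ) ^ j)
      with hAj
    set Ej : ℝ := Real.exp (-(a₀ / 3 * ((((P.L : ℝ) ^ k) - 1) / (P.L : ℝ) ^ j))) with hEj
    set Ehalf : ℝ := Real.exp (-(a₀ / 6 * ((((P.L : ℝ) ^ k) - 1) / (P.L : ℝ) ^ j))) with hEhalf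
    set Wj : ℝ := 2 * (1 + 2 * (P.L : ℝ) ^ j / a₁) with hWj
    set Λ : ℝ := ((P.L : ℝ) ^ (k - j)) ^ (P.d - 2) with hΛ
    have hAj0 : 0 ≤ Aj := by rw [hAj]; positivity
    have hEj0 : 0 ≤ Ej := (Real.exp_pos _).le
    have hEhalf0 : 0 ≤ Ehalf := (Real.exp_pos _).le
    have hWj0 : 0 ≤ Wj := by rw [hWj]; positivity
    have hΛ0 : 0 ≤ Λ := by rw [hΛ]; positivity
    have hEsplit : Ej = Ehalf * Ehalf := by rw [hEj, hEhalf, ← Real.exp_add]; congr 1; ring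
    -- per p (charged or not)
    have hp : ∀ p : TPlaq P k, ∑ t ∈ range (P.L ^ k), |g p| * |T t p j| ≤
        C * (Aj * Ej * Wj * Real.exp (3 * a₁ / 4) * Real.exp (-(a₁ / 2 * distEU P k x₀ p.src))) := by
      intro p
      by_cases hgp : g p = 0
      · simp only [hgp, abs_zero, zero_mul, Finset.sum_const_zero]
        positivity
      · rw [← Finset.mul_sum]
        calc |g p| * ∑ t ∈ range (P.L ^ k), |T t p j|
            ≤ C * (Aj * (Ej * (Wj * Real.exp (3 * a₁ / 4) * Real.exp (-(a₁ / 2 * distEU P k x₀ p.src))))) :=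
              mul_le_mul (hg p) (hline p j hjk hgp) (Finset.sum_nonneg fun _ _ => abs_nonneg _) hC0
          _ = _ := by ring
    have hS := sum_exp_neg_distEU_le hk (half_pos ha₁p) x₀
    have hsum : ∑ p : TPlaq P k, ∑ t ∈ range (P.L ^ k), |g p| * |T t p j| ≤ C * (Aj * Ej * Wj * Real.exp (3 * a₁ / 4)) * S'' := by
      calc _ ≤ ∑ p : TPlaq P k, C * (Aj * Ej * Wj * Real.exp (3 * a₁ / 4) * Real.exp (-(a₁ / 2 * distEU P k x₀ p.src))) :=
            Finset.sum_le_sum fun p _ => hp p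
        _ = C * (Aj * Ej * Wj * Real.exp (3 * a₁ / 4)) * ∑ p : TPlaq P k, Real.exp (-(a₁ / 2 * distEU P k x₀ p.src)) := by
            rw [Finset.mul_sum]; refine Finset.sum_congr rfl fun p _ => by ring
        _ ≤ C * (Aj * Ej * Wj * Real.exp (3 * a₁ / 4)) *
              ((P.d : ℝ) ^ 2 * ∑ y : TSite P k, Real.exp (-(a₁ / 2 * distEU P k x₀ y))) :=
            mul_le_mul_of_nonneg_left (sum_plaq_src_le' (fun y => Real.exp (-(a₁ / 2 * distEU P k x₀ y)))
              fun _ => (Real.exp_pos _).le) (by positivity)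
        _ ≤ C * (Aj * Ej * Wj * Real.exp (3 * a₁ / 4)) * S'' := by
            rw [hS'']
            exact mul_le_mul_of_nonneg_left (mul_le_mul_of_nonneg_left hS (by positivity)) (by positivity)
    -- η·Aj·Wj ≤ (2M²M_Cd²K1)·W'·Λ
    have hkey : ((P.L : ℝ) ^ k)⁻¹ * ((P.L : ℝ) ^ k / (P.L : ℝ) ^ j) * (2 * (1 + 2 * (P.L : ℝ) ^ j / a₁)) ≤ 2 * (1 + 2 / a₁) := by
      have hLkne : (P.L : ℝ) ^ k ≠ 0 := hLk.ne'
      have hLjne : (P.L : ℝ) ^ j ≠ 0 := hLj.ne'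
      have ha₁ne : a₁ ≠ 0 := ha₁p.ne'
      have e : ((P.L : ℝ) ^ k)⁻¹ * ((P.L : ℝ) ^ k / (P.L : ℝ) ^ j) * (2 * (1 + 2 * (P.L : ℝ) ^ j / a₁)) =
          2 * (((P.L : ℝ) ^ j)⁻¹ + 2 / a₁) := by
        field_simp
      rw [e]
      have : ((P.L : ℝ) ^ j)⁻¹ ≤ 1 := inv_le_one_of_one_le₀ hLj1
      linarith
    have hηAW : P.eta k * Aj * Wj ≤ 2 * M ^ 2 * MC * (P.d : ℝ) ^ 2 * K1 * W' * Λ := by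
      rw [hAj, hWj, hηk, hW', hΛ]
      have hfac : 0 ≤ 2 * M ^ 2 * MC * (P.d : ℝ) ^ 2 * K1 * ((P.L : ℝ) ^ (k - j)) ^ (P.d - 2) := by positivity
      calc ((P.L : ℝ) ^ k)⁻¹ * (2 * M ^ 2 * (MC * ((P.L : ℝ) ^ (k - j)) ^ (P.d - 2)) * (P.d : ℝ) ^ 2 * K1 *
            ((P.L : ℝ) ^ k / (P.L : ℝ) ^ j)) * (2 * (1 + 2 * (P.L : ℝ) ^ j / a₁))
          = (2 * M ^ 2 * MC * (P.d : ℝ) ^ 2 * K1 * ((P.L : ℝ) ^ (k - j)) ^ (P.d - 2)) *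
              (((P.L : ℝ) ^ k)⁻¹ * ((P.L : ℝ) ^ k / (P.L : ℝ) ^ j) * (2 * (1 + 2 * (P.L : ℝ) ^ j / a₁))) := by ring
        _ ≤ (2 * M ^ 2 * MC * (P.d : ℝ) ^ 2 * K1 * ((P.L : ℝ) ^ (k - j)) ^ (P.d - 2)) * (2 * (1 + 2 / a₁)) :=
            mul_le_mul_of_nonneg_left hkey hfac
        _ = _ := by ring
    -- the two halves of the far factor
    have hEr : Ehalf ≤ r ^ (k - j) := by rw [hEhalf, hr]; exact exp_far_le hjk ha₀p.le
    have hΛE : Λ * Ehalf ≤ Kpoly := by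
      rw [hΛ, hEhalf, hKpoly]
      exact pow_mul_exp_far_le hjk (by positivity) (P.d - 2)
    calc P.eta k * ∑ p : TPlaq P k, ∑ t ∈ range (P.L ^ k), |g p| * |T t p j|
        ≤ P.eta k * (C * (Aj * Ej * Wj * Real.exp (3 * a₁ / 4)) * S'') := mul_le_mul_of_nonneg_left hsum (eta_pos P k).le
      _ = C * ((P.eta k * Aj * Wj) * Real.exp (3 * a₁ / 4) * S'') * Ej := by ring
      _ ≤ C * ((2 * M ^ 2 * MC * (P.d : ℝ) ^ 2 * K1 * W' * Λ) * Real.exp (3 * a₁ / 4) * S'') * Ej := by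
          refine mul_le_mul_of_nonneg_right (mul_le_mul_of_nonneg_left ?_ hC0) hEj0
          exact mul_le_mul_of_nonneg_right (mul_le_mul_of_nonneg_right hηAW (Real.exp_pos _).le) (by rw [hS'']; positivity)
      _ = C * (2 * M ^ 2 * MC * (P.d : ℝ) ^ 2 * K1 * (W' * Real.exp (3 * a₁ / 4) * S'')) * ((Λ * Ehalf) * Ehalf) := by
          rw [hEsplit]; ring
      _ ≤ C * (2 * M ^ 2 * MC * (P.d : ℝ) ^ 2 * K1 * (W' * Real.exp (3 * a₁ / 4) * S'')) * (Kpoly * r ^ (k - j)) :=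
          mul_le_mul_of_nonneg_left (mul_le_mul hΛE hEr hEhalf0 hKpoly0) (by positivity)
      _ = C * Kf * r ^ (k - j) := by rw [hKf]; ring
  -- the geometric sum over the scales
  have hgeom : ∑ j ∈ Finset.range k, r ^ (k - j) ≤ (1 - r)⁻¹ := by
    calc ∑ j ∈ Finset.range k, r ^ (k - j) ≤ ∑ j ∈ Finset.range k, r ^ (k - 1 - j) :=
          Finset.sum_le_sum fun j hj => pow_le_pow_of_le_one hr0 hr1' (by have := Finset.mem_range.1 hj; omega)
      _ = ∑ j ∈ Finset.range k, r ^ j := Finset.sum_range_reflect (fun j => r ^ j) k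
      _ ≤ (1 - r)⁻¹ := geom_sum_le_inv hr0 hr1 k
  -- assemble
  rw [hrepr]
  calc P.eta k * |∑ t ∈ range (P.L ^ k), ∑ p : TPlaq P k, g p * ∑ j ∈ Finset.range k, T t p j|
      ≤ P.eta k * ∑ t ∈ range (P.L ^ k), ∑ p : TPlaq P k, ∑ j ∈ Finset.range k, |g p| * |T t p j| := by
        refine mul_le_mul_of_nonneg_left ((Finset.abs_sum_le_sum_abs _ _).trans (Finset.sum_le_sum fun t _ =>
          (Finset.abs_sum_le_sum_abs _ _).trans (Finset.sum_le_sum fun p _ => ?_))) (eta_pos P k).le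
        rw [abs_mul, ← Finset.mul_sum]
        exact mul_le_mul_of_nonneg_left (Finset.abs_sum_le_sum_abs _ _) (abs_nonneg _)
    _ = ∑ j ∈ Finset.range k, P.eta k * ∑ p : TPlaq P k, ∑ t ∈ range (P.L ^ k), |g p| * |T t p j| := by
        have e : ∑ t ∈ range (P.L ^ k), ∑ p : TPlaq P k, ∑ j ∈ Finset.range k, |g p| * |T t p j| =
            ∑ j ∈ Finset.range k, ∑ p : TPlaq P k, ∑ t ∈ range (P.L ^ k), |g p| * |T t p j| := by
          calc ∑ t ∈ range (P.L ^ k), ∑ p : TPlaq P k, ∑ j ∈ Finset.range k, |g p| * |T t p j|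
              = ∑ t ∈ range (P.L ^ k), ∑ j ∈ Finset.range k, ∑ p : TPlaq P k, |g p| * |T t p j| :=
                Finset.sum_congr rfl fun t _ => Finset.sum_comm
            _ = ∑ j ∈ Finset.range k, ∑ t ∈ range (P.L ^ k), ∑ p : TPlaq P k, |g p| * |T t p j| := Finset.sum_comm
            _ = _ := Finset.sum_congr rfl fun j _ => Finset.sum_comm
        rw [e, Finset.mul_sum]
    _ ≤ ∑ j ∈ Finset.range k, C * Kf * r ^ (k - j) := Finset.sum_le_sum hscale
    _ = C * Kf * ∑ j ∈ Finset.range k, r ^ (k - j) := by rw [Finset.mul_sum]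
    _ ≤ C * Kf * (1 - r)⁻¹ := mul_le_mul_of_nonneg_left hgeom (by positivity)
    _ = Kf * (1 - r)⁻¹ * C := by ring
    _ = _ := by rw [hKf, hK1, hS'', hW', hKpoly, ha₁, hr, ha₀]

end

end Literature.MathematicalPhysics.QuantumFieldTheory.BalabanImbrieJaffe1984to88.BIJ85EdgeColumnSums
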